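import Literature.AnabelianGeometry.AbsoluteAnabelian.AbsTopIII.KummerFaithfulPadicProofs
import Literature.AnabelianGeometry.AbsoluteAnabelian.AbsTopIII.KummerFaithfulFGExtensionProofs
import Literature.AnabelianGeometry.AbsoluteAnabelian.SubpadicFiniteExtension
import Literature.AnabelianGeometry.AbsoluteAnabelian.AbsTopIII.KummerFaithfulCyclotomicProofs
import Literature.AnabelianGeometry.AbsoluteAnabelian.FundamentalExtension
import HarnessLib

/-!
# [AbsTopIII] Remark 1.5.4 (i), torus half: sub-`p`-adic fields are torally Kummer-faithful

Proof-only companion (no new definitions) to `AbsTopIII/KummerFaithful.lean`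
(S. Mochizuki, *Topics in Absolute Anabelian Geometry III*, §1, Rmk. 1.5.4 (i), manuscript p. 33,
lit key `paper:url-5493eb38cbb7`): "Observe that every sub-`p`-adic field `k` [cf. [Mzk5],
Definition 15.4, (i)] is Kummer-faithful [...]. Indeed, to verify this, one reduces immediately, by
base-change, to the case where `k` is a finitely generated extension of an MLF [...]. Then by
restricting to various closed points of this variety, one reduces to the case where `k` itself is an
MLF."

What is kernel-checked here is the TORUS HALF of the named fact `Rmk_1_5_4_i`
(`IsSubpadic k → IsKummerFaithful k`, where `IsKummerFaithful = torally ∧ abelian-variety clause`):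

* `IsTorallyKummerFaithful.of_embedding_into_fg` : a field embedding into a finitely generated
  extension of a torally Kummer-faithful field is torally Kummer-faithful ("by base-change": a
  finite extension of `k` embeds into a finitely generated extension of the base, which is torally
  Kummer-faithful by Rmk. 1.5.4 (ii) = `Rmk_1_5_4_ii_holds`, and condition (a) passes to subgroups);
* `IsSubpadicFor.isTorallyKummerFaithful`, `IsSubpadic.isTorallyKummerFaithful`,
  `Rmk_1_5_4_i_torally` : sub-`p`-adic ⟹ torally Kummer-faithful (base `ℚ_p` torally
  Kummer-faithful by `isTorallyKummerFaithful_padic`, the MLF case of p. 33);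
* `IsMLF.isTorallyKummerFaithful` : every MLF is torally Kummer-faithful;
* `IsSubpadic.isOpen_range_cyclotomicChar`, `IsMLF.isOpen_range_cyclotomicChar` : Rmk. 1.5.1
  (`Rmk_1_5_1_holds`, abc-iut-L4-d1) composed with the above — for a sub-`p`-adic field, in
  particular for every MLF, the `l`-adic cyclotomic character `χ_l : G_k → ℤ_l^×` has open image
  (the form in which [AbsTopIII] Thm. 1.9 (a) p. 37 / [AbsTopI] Lem. 4.5 use it);
* `Rmk_1_5_4_i_of_abelianVariety_clause` : the named fact `Rmk_1_5_4_i` follows once the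
  ABELIAN-VARIETY clause of Def. 1.5 (a) for sub-`p`-adic fields is granted (stated inline as a
  hypothesis; it is Mattuck's structure theorem for `A(K)`, `K` a `p`-adic field, plus the
  base-change/specialisation reduction of p. 33 — NOT proved here and NOT asserted).

HONEST FRAMING: classical facts about `p`-adic fields, our kernel check of a refereed remark;
nothing here bears on [IUTchIII] Cor. 3.12; the abelian-variety clause remains an explicit
hypothesis (typed ≠ discharged).
-/

noncomputable section

open scoped Classical

namespace Literature.AnabelianGeometry.AbsoluteAnabelian.AbsTopIII

universe u

/-- Condition (a) of Def. 1.5 passes to subgroups: if `G` embeds in `H` and `H` has no nontrivial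
infinitely divisible element, neither has `G`. [cite: MochizukiAbsTopIII2015, Def 1.5 (a) p.32] -/
private theorem DivisibleElementsTrivial.of_injective {G H : Type*} [CommGroup G] [CommGroup H]
    (f : G →* H) (hf : Function.Injective f) (h : DivisibleElementsTrivial H) :
    DivisibleElementsTrivial G := by
  refine ⟨fun x hx => hf ?_⟩
  rw [map_one]
  refine h.eq_one_of_forall_exists_pow (f x) fun n hn => ?_
  obtain ⟨y, hy⟩ := hx n hn
  exact ⟨f y, by rw [← map_pow, hy]⟩

/-- "By base-change" (Rmk. 1.5.4 (i) p. 33): a field `k` that embeds into a finitely generated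
extension of a torally Kummer-faithful field `B` is torally Kummer-faithful — a finite extension
`k'` of `k` embeds into a finitely generated extension `L'` of `B` (`exists_fg_extension_of_finite`),
`L'` is torally Kummer-faithful by Rmk. 1.5.4 (ii) (`Rmk_1_5_4_ii_holds`), and
`⋂_N (k'^×)^N ↪ ⋂_N (L'^×)^N = {1}`. [cite: MochizukiAbsTopIII2015, Rmk 1.5.4 (i) p.33] -/
theorem IsTorallyKummerFaithful.of_embedding_into_fg {B : Type} [Field B]
    (hB : IsTorallyKummerFaithful B) {k : Type u} [Field k]
    (h : ∃ (L : Type) (_ : Field L) (_ : Algebra B L),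
      (⊤ : IntermediateField B L).FG ∧ Nonempty (k →+* L)) :
    IsTorallyKummerFaithful k := by
  obtain ⟨L, _, _, _, ⟨ι⟩⟩ := id h
  haveI : CharZero B := hB.charZero
  haveI : CharZero L := charZero_of_injective_algebraMap (algebraMap B L).injective
  haveI : CharZero k := ι.charZero
  refine ⟨inferInstance, fun k' _ _ hfin => ?_⟩
  haveI := hfin
  obtain ⟨L', _, _, hL', ⟨ι'⟩⟩ := exists_fg_extension_of_finite (B := B) (k := k) (F := k') h
  have hL'KF : IsTorallyKummerFaithful L' := Rmk_1_5_4_ii_holds B L' hL' hB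
  have hdiv : DivisibleElementsTrivial L'ˣ := hL'KF.units L' (Module.Finite.self L')
  exact DivisibleElementsTrivial.of_injective (Units.map (ι' : k' →* L'))
    (Units.map_injective ι'.injective) hdiv

/-- [AbsTopIII] Rmk. 1.5.4 (i), TORUS HALF, prime-indexed form: a sub-`p`-adic field is torally
Kummer-faithful ("sub-`p`-adic ⟹ Kummer-faithful", restricted to tori; base case = MLF's,
`isTorallyKummerFaithful_padic`). [cite: MochizukiAbsTopIII2015, Rmk 1.5.4 (i) p.33] -/
theorem IsSubpadicFor.isTorallyKummerFaithful {k : Type u} [Field k] {p : ℕ} [Fact p.Prime]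
    (h : IsSubpadicFor k p) : IsTorallyKummerFaithful k :=
  IsTorallyKummerFaithful.of_embedding_into_fg (isTorallyKummerFaithful_padic p) h.exists_embedding

/-- [AbsTopIII] Rmk. 1.5.4 (i), TORUS HALF: a sub-`p`-adic field is torally Kummer-faithful.
[cite: MochizukiAbsTopIII2015, Rmk 1.5.4 (i) p.33] -/
theorem IsSubpadic.isTorallyKummerFaithful {k : Type u} [Field k] (h : IsSubpadic k) :
    IsTorallyKummerFaithful k := by
  obtain ⟨p, hp, hk⟩ := h.exists_prime
  exact hk.isTorallyKummerFaithful

/-- [AbsTopIII] Rmk. 1.5.4 (i), TORUS HALF, in the shape of the named fact `Rmk_1_5_4_i` with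
`IsKummerFaithful` weakened to `IsTorallyKummerFaithful`: "sub-`p`-adic ⟹ [torally]
Kummer-faithful". [cite: MochizukiAbsTopIII2015, Rmk 1.5.4 (i) p.33] -/
theorem Rmk_1_5_4_i_torally :
    ∀ (k : Type u) [Field k], IsSubpadic k → IsTorallyKummerFaithful k :=
  fun _ _ h => h.isTorallyKummerFaithful

/-- Every MLF ([AbsTopI] §0: a finite extension of some `ℚ_p`; the cell's `IsMLF`) is torally
Kummer-faithful — the case "`k` itself is an MLF" of Rmk. 1.5.4 (i) p. 33, torus part.
[cite: MochizukiAbsTopIII2015, Rmk 1.5.4 (i) p.33] -/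
theorem _root_.Literature.AnabelianGeometry.AbsoluteAnabelian.IsMLF.isTorallyKummerFaithful
    {K : Type u} [Field K] (h : IsMLF K) :
    IsTorallyKummerFaithful K := by
  obtain ⟨p, hp, f, hf⟩ := h.exists_padic
  letI : Algebra ℚ_[p] K := f.toAlgebra
  haveI : Module.Finite ℚ_[p] K := hf
  exact isTorallyKummerFaithful_of_finite_padic p K

/-- [AbsTopIII] Rmk. 1.5.1 for sub-`p`-adic fields (Rmk. 1.5.1 p. 32 ∘ Rmk. 1.5.4 (i) p. 33): for
a sub-`p`-adic field `k` and any prime `l`, the `l`-adic cyclotomic character `χ_l : G_k → ℤ_l^×`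
has open image. [cite: MochizukiAbsTopIII2015, Rmk 1.5.1 p.32] -/
theorem IsSubpadic.isOpen_range_cyclotomicChar {k : Type u} [Field k] (h : IsSubpadic k)
    (l : ℕ) [Fact l.Prime] : IsOpen (Set.range (cyclotomicChar k l)) :=
  Rmk_1_5_1_holds k h.isTorallyKummerFaithful l

/-- [AbsTopIII] Rmk. 1.5.1 for MLF's: for an MLF `K` and any prime `l`, the `l`-adic cyclotomic
character `χ_l : G_K → ℤ_l^×` has open image (`K` is torally Kummer-faithful by Rmk. 1.5.4 (i)).
[cite: MochizukiAbsTopIII2015, Rmk 1.5.1 p.32] -/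
theorem _root_.Literature.AnabelianGeometry.AbsoluteAnabelian.IsMLF.isOpen_range_cyclotomicChar
    {K : Type u} [Field K] (h : IsMLF K) (l : ℕ) [Fact l.Prime] : IsOpen (Set.range (cyclotomicChar K l)) :=
  Rmk_1_5_1_holds K h.isTorallyKummerFaithful l

open Literature.AlgebraicGeometry.Motives in
/-- The named fact `Rmk_1_5_4_i` ("sub-`p`-adic ⟹ Kummer-faithful", [AbsTopIII] Rmk. 1.5.4 (i)
p. 33) CONDITIONALLY on its abelian-variety clause: the torus half is `Rmk_1_5_4_i_torally`
(proved); the hypothesis `hAV` is condition (a) of Def. 1.5 for abelian varieties over finite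
extensions of sub-`p`-adic fields (in print: "`A(k_H)` is an extension of a finitely generated
`ℤ`-module by a compact abelian `p`-adic Lie group", p. 33, plus the base-change / closed-point
reduction) — NOT proved here. [cite: MochizukiAbsTopIII2015, Rmk 1.5.4 (i) p.33] -/
theorem Rmk_1_5_4_i_of_abelianVariety_clause
    (hAV : ∀ (k : Type u) [Field k], IsSubpadic k →
      ∀ (k' : Type u) [Field k'] [Algebra k k'], Module.Finite k k' →
        ∀ A : AbelianVariety k', DivisibleElementsTrivial (A.Points k')) :
    Rmk_1_5_4_i.{u} :=
  fun k _ hk => ⟨hk.isTorallyKummerFaithful, hAV k hk⟩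

end Literature.AnabelianGeometry.AbsoluteAnabelian.AbsTopIII
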